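import Summits.QuantumFields.QCD.Theorems.HeatSlicedQuarksInterleavedHeatSliceFlowStubColumnIdentificationAux

/-!
# Stub `stub_gammaFiveDiagonal` of line `Sketch`
(crux `Summit.QuantumFields.QCD.Theses.HeatSlicedQuarks.InterleavedHeatSliceFlow`, item stmt-QuantumFields-8891)

The on-diagonal entries of the two T*T heat kernels of the `r = 1` Wilson–Dirac matrix `D = D_W(U, m, 1)`
agree:

  `e^{-t D Dᴴ}(η, η) = e^{-t Dᴴ D}(η, η)`   for every site/colour/spin index `η` and every real `t`.

Proof.  γ₅-hermiticity (`wilsonDirac_gammaFive_hermitian_holds`, PROVED in the Literature tree): `Γ D Γ = Dᴴ`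
with `Γ = spinorLift γ₅`, `Γ² = 1` (`spinorLift_gammaFive_mul_self`), and `Γ = diag(ε_{spin})`,
`ε = (1, 1, -1, -1)` (`spinorLift_gammaFive_eq_diagonal`).  Hence `D Dᴴ = D Γ D Γ` and `Dᴴ D = Γ D Γ D`, so
`X Γ = Γ Y` for `X = -t D Dᴴ`, `Y = -t Dᴴ D`; the landed intertwining lemma `exp_mul_eq_mul_exp_of_comm`
gives `e^X Γ = Γ e^Y`, i.e. `e^X = Γ e^Y Γ`, and conjugating by the diagonal sign matrix `Γ` does not change
diagonal entries (`ε² = 1`).  Finite-dimensional linear algebra only; no named facts are used.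
-/

noncomputable section

namespace Summit.QuantumFields.QCD.Cruxes.InterleavedHeatSliceFlow.Sketch

open Literature.MathematicalPhysics.QuantumLattice Literature.MathematicalPhysics.QuantumFieldTheory
  Literature.Probability.LatticeModels
open scoped Matrix ComplexConjugate

section Generic

variable {ι : Type} [Fintype ι] [DecidableEq ι]

/-- Conjugating by a diagonal matrix of signs does not change diagonal entries: if `d i * d i = 1` for all `i`,
then `(diag d * M * diag d) i i = M i i`. -/
theorem diagonal_mul_mul_diagonal_apply_self (d : ι → ℂ) (hd : ∀ i, d i * d i = 1) (M : Matrix ι ι ℂ)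
    (i : ι) : (Matrix.diagonal d * M * Matrix.diagonal d) i i = M i i := by
  rw [Matrix.mul_diagonal, Matrix.diagonal_mul, mul_right_comm, hd, one_mul]

/-- If `P² = 1` and `P` intertwines `X` and `Y` (`X P = P Y`), then `exp X = P · exp Y · P`
(the landed `exp_mul_eq_mul_exp_of_comm`, multiplied on the right by `P`). -/
theorem exp_eq_conj_of_mul_self_eq_one (X Y P : Matrix ι ι ℂ) (hP : P * P = 1) (h : X * P = P * Y) :
    NormedSpace.exp X = P * NormedSpace.exp Y * P := by
  have h1 := exp_mul_eq_mul_exp_of_comm X Y P h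
  calc NormedSpace.exp X = NormedSpace.exp X * (P * P) := by rw [hP, Matrix.mul_one]
    _ = NormedSpace.exp X * P * P := by rw [Matrix.mul_assoc]
    _ = P * NormedSpace.exp Y * P := by rw [h1]

end Generic

section Wilson

variable {L : ℕ} [NeZero L]

/-- **γ₅ intertwines the two T*T generators of the Wilson–Dirac matrix**: with `D = D_W(U, m, 1)` and
`Γ = spinorLift γ₅`, `(-t • D Dᴴ) Γ = Γ (-t • Dᴴ D)` — from `Γ D Γ = Dᴴ` and `Γ² = 1`:
both sides equal `-t • D Γ D`. -/
theorem neg_smul_mul_conjTranspose_wilsonDirac_mul_spinorLift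
    (U : GaugeConfig 4 L (Matrix.specialUnitaryGroup (Fin 3) ℂ)) (m t : ℝ) :
    (-(t : ℂ) • (wilsonDirac (fundamentalRep (Fin 3)) U m 1 * (wilsonDirac (fundamentalRep (Fin 3)) U m 1)ᴴ)) *
        spinorLift gammaFive =
      spinorLift gammaFive *
        (-(t : ℂ) • ((wilsonDirac (fundamentalRep (Fin 3)) U m 1)ᴴ *
          wilsonDirac (fundamentalRep (Fin 3)) U m 1)) := by
  set D := wilsonDirac (fundamentalRep (Fin 3)) U m 1 with hD
  set Γ : Matrix (TorusSite 4 L × Fin 3 × Fin 4) (TorusSite 4 L × Fin 3 × Fin 4) ℂ :=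
    spinorLift gammaFive with hΓdef
  have hΓ : Γ * D * Γ = Dᴴ :=
    wilsonDirac_gammaFive_hermitian_holds (L := L) (fundamentalRep (Fin 3)) fundamentalRep_mem_unitaryGroup
      U m 1
  have hsq : Γ * Γ = 1 := spinorLift_gammaFive_mul_self
  rw [Matrix.smul_mul, Matrix.mul_smul, ← hΓ]
  congr 1
  calc D * (Γ * D * Γ) * Γ = D * (Γ * D) * (Γ * Γ) := by simp only [Matrix.mul_assoc]
    _ = D * (Γ * D) := by rw [hsq, Matrix.mul_one]
    _ = Γ * Γ * D * (Γ * D) := by rw [hsq, Matrix.one_mul]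
    _ = Γ * (Γ * D * Γ * D) := by simp only [Matrix.mul_assoc]

/-- **The two Wilson T*T heat kernels are γ₅-conjugate**: `e^{-t D Dᴴ} = Γ e^{-t Dᴴ D} Γ`,
`Γ = spinorLift γ₅`, `D = D_W(U, m, 1)`. -/
theorem exp_neg_smul_mul_conjTranspose_wilsonDirac_eq_conj
    (U : GaugeConfig 4 L (Matrix.specialUnitaryGroup (Fin 3) ℂ)) (m t : ℝ) :
    NormedSpace.exp (-(t : ℂ) • (wilsonDirac (fundamentalRep (Fin 3)) U m 1 *
        (wilsonDirac (fundamentalRep (Fin 3)) U m 1)ᴴ)) =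
      spinorLift gammaFive *
        NormedSpace.exp (-(t : ℂ) • ((wilsonDirac (fundamentalRep (Fin 3)) U m 1)ᴴ *
          wilsonDirac (fundamentalRep (Fin 3)) U m 1)) * spinorLift gammaFive :=
  exp_eq_conj_of_mul_self_eq_one _ _ _ spinorLift_gammaFive_mul_self
    (neg_smul_mul_conjTranspose_wilsonDirac_mul_spinorLift U m t)

end Wilson

/-- **Stub `stub_gammaFiveDiagonal`** (registered stub of line `Sketch`, reshape r7, sliced Gram bound): the
on-diagonal entries of the two T*T heat kernels of the Wilson–Dirac matrix agree,
`e^{-t D_W D_Wᴴ}(η, η) = e^{-t D_Wᴴ D_W}(η, η)` — by γ₅-hermiticity (`wilsonDirac_gammaFive_hermitian_holds`: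
`Γ D_W Γ = D_Wᴴ`, `Γ = spinorLift γ₅`, `Γ² = 1`) one has `e^{-t D Dᴴ} = Γ e^{-t Dᴴ D} Γ`
(`exp_neg_smul_mul_conjTranspose_wilsonDirac_eq_conj`), and `Γ = 1 ⊗ 1 ⊗ diag(1, 1, -1, -1)`
(`spinorLift_gammaFive_eq_diagonal`) is diagonal with entries `±1`, so the conjugation leaves the diagonal
unchanged. -/
theorem stub_gammaFiveDiagonal :
    ∀ (L : ℕ) [NeZero L] (U : GaugeConfig 4 L (Matrix.specialUnitaryGroup (Fin 3) ℂ)) (m t : ℝ)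
      (η : TorusSite 4 L × Fin 3 × Fin 4),
      (NormedSpace.exp (-(t : ℂ) • (wilsonDirac (fundamentalRep (Fin 3)) U m 1 *
          (wilsonDirac (fundamentalRep (Fin 3)) U m 1)ᴴ))) η η =
        (NormedSpace.exp (-(t : ℂ) • ((wilsonDirac (fundamentalRep (Fin 3)) U m 1)ᴴ *
          wilsonDirac (fundamentalRep (Fin 3)) U m 1))) η η := by
  intro L _ U m t η
  rw [exp_neg_smul_mul_conjTranspose_wilsonDirac_eq_conj U m t, spinorLift_gammaFive_eq_diagonal]
  exact diagonal_mul_mul_diagonal_apply_self _ (fun i => gammaFiveSign_mul_self i.2.2) _ η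

end Summit.QuantumFields.QCD.Cruxes.InterleavedHeatSliceFlow.Sketch

end
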